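import Summits.HodgeConjecture.HodgeConjecture.Theorems.R90S5ThetaMemberLocalData         -- ★ `IsThetaOfRecord` ∕ `IsThetaMemberAt` (re-exported) + the obligations `norm_thetaSplitChar_apply`, `continuous_thetaSplitChar`
import Summits.HodgeConjecture.HodgeConjecture.Theorems.R90S5OneDimNotThetaMemberLocal    -- ★ R90-C14-p03: `not_isConstituentOf_parabolicIndGL_two_comap_of_finrank_eq_one` (the SPLIT local lemma)
import Summits.HodgeConjecture.HodgeConjecture.Theorems.K2E1InfinitelyManySplitPlaces     -- ★ `cm_exists_split_notMem_of_eventually` (infinitely many split places of `L⁺`)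
import Literature.NumberTheory.Automorphic.AdicCompletionLocalField                      -- ★ instance `IsNonarchimedeanLocalField (w.adicCompletion L)`
import Literature.NumberTheory.Automorphic.ParabolicInduction                            -- ★ instance `LocallyCompactSpace (standardParabolicGL F c)`
import HarnessLib

/-!
# R90 · S5 — law (T′) GLOBAL ASSEMBLY: a family of local classes of `U(Φ₂)` that is ONE-DIMENSIONAL at the split places is never `ρ(θ)`, `θ` regular
# (`¬ R90.S5.IsThetaOfRecord μω π₂`) [Rogawski1990, §11.1 Prop. 11.1.1 (a) p. 161; §11.4 Prop. 11.4.1 (a) p. 166; §13.8 p. 218]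

R90-TF SLAB (brief v2 1f40d54518340a35), section S5 (Ch. 13.3, base `R90-C133`), dealer R90-C133-plan (g0) DEAL #17b′ (2026-09-04T16:37:52Z, RULING (T′-GLOBAL):
«the NON-SPLIT local theorem is NOT NEEDED for law (T′) — `IsThetaOfRecord` quantifies over ALL cofinite `v`, and a cofinite set of places of `L⁺` meets the
INFINITE set of split places»); seat R90-C14-p02 (g0); crux H413 = `stmt-HodgeConjecture-24833`, route `HCCMUnconditional`, lane `--supports … --as helper`.
ONE theorem; no definition, no instance, no notation, no `sorry`; imports ★ Theorems ∕ Literature only.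

THE STATEMENT.  `μω` Rogawski's auxiliary unitary Hecke character, `π₂ = (π₂,v)_v` a family of classes of `U(Φ₂)(L⁺_v)`; IF at every SPLIT place `v` the class
`π₂,v` is ONE-DIMENSIONAL (`π₂ v = ⟦r⟧` with `Module.finrank ℂ r.V = 1` — e.g. the local components `η_v ∘ det` of a one-dimensional automorphic
representation), THEN `π₂` is NOT of the form `ρ(θ₁ ⊗ θ₃)`, `θ₁ ≠ θ₃` (★ `R90.S5.IsThetaOfRecord`, R90-C133-p03's relational θ-currency).  This is the
content behind S5-C's law (T′) `stub_R90_S5_oneDim_notTheta` («a one-dimensional `U(2)`-representation is never a θ-member»): print — the discrete packets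
`ρ(θ)`, `θ` regular, of `U(2)` consist of infinite-dimensional (tempered) classes [Prop. 11.1.1 (a)(e)]; at a split place `ρ̃(θ)_w = i_{GL₂}(θ̃₁μ⁻¹, θ̃₃μ⁻¹)`
[Prop. 11.4.1 (a)] is an IRREDUCIBLE unitary principal series [Zelevinsky1980 Thm. 4.2], not a character.

THE PROOF (dealer's cut).  Unfold `IsThetaOfRecord`: `θ₁, θ₃` automorphic and `∀ᶠ v in cofinite, IsThetaMemberAt … v (π₂ v)`.  Split places of `L⁺` are
infinite (★ `K2E1InfinitelyManySplitPlaces`), so some split `v` carries the membership (★ `cm_exists_split_notMem_of_eventually`).  The SPLIT clause of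
★ `IsThetaMemberAt` at the fixed witness `w = splitWitness v hs` says that `IrrClass.comap (localSplitEquiv …).symm (π₂ v)` is a constituent of
`i_{GL₂(L_w)}(ν₁, ν₃)`, `νᵢ = ((pullback θᵢ)·μω⁻¹)_w`; the `νᵢ` are unitary and continuous (★ `norm_thetaSplitChar_apply`, `continuous_thetaSplitChar`, p861977),
so R90-C14-p03's ★ split lemma `not_isConstituentOf_parabolicIndGL_two_comap_of_finrank_eq_one` (irreducibility of the unitary principal series of `GL₂`
★ `parabolicIndGL_detChar_unitary_isIrreducible_holds` + «it is not a line») refutes it for one-dimensional `π₂ v`.  The instance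
`LocallyCompactSpace (standardParabolicGL (L_w) (lastBlockLabel 2))` demanded by the clause is ★ `instLocallyCompactSpaceStandardParabolicGL` over ★
`IsNonarchimedeanLocalField (w.adicCompletion L)`.  No non-split information is used (census `R90/S5/R90-C14-p02/CENSUS-OneDimNotThetaNonsplit.md`
6d7b332c5dc8c7f7 records why the non-split local twin would need a Satake∕unitarity input the tree lacks — and why it is unnecessary).

HONEST LABEL: HC_CM is proved only modulo the 7 printed citations (2 remaining named inputs: hLiu418 = stmt-HodgeConjecture-24832, h413 = stmt-HodgeConjecture-24833)
until rung 0 closes; this file is UNCONDITIONAL (no named hypothesis) and closes nothing global by itself — it feeds S5-C's law (T′) BY NAME.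

## References
* [Rogawski1990] J. D. Rogawski, *Automorphic Representations of Unitary Groups in Three Variables*, Ann. of Math. Stud. 123 (1990): §11.1 Prop. 11.1.1 (a) p. 161;
  §11.4 Prop. 11.4.1 (a) p. 166; §13.8 p. 218 (auxiliary split places).
* [Zelevinsky1980] A. V. Zelevinsky, *Induced representations of reductive p-adic groups II*, Ann. Sci. ÉNS 13 (1980), Thm. 4.2.
* [Marcus2018] D. A. Marcus, *Number Fields*, 2nd ed. (2018), Ch. 4 Exercise 30 (b) (infinitely many split primes).
-/

set_option autoImplicit false
-- the mandated namespace repeats the single-problem summit's segment (`HodgeConjecture.HodgeConjecture`)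
set_option linter.dupNamespace false

noncomputable section

namespace Summit.HodgeConjecture.HodgeConjecture.R90.S5

open NumberField IsDedekindDomain Filter
open Literature.NumberTheory.Rogawski1990 Literature.NumberTheory.GaloisRepresentations
open Literature.NumberTheory.Automorphic Literature.NumberTheory.Automorphic.UnitaryGroup
open Literature.NumberTheory.Automorphic.Arthur2013.Leaves.TECR
open Summit.HodgeConjecture.HodgeConjecture.Cruxes.H413.K2E1InfinitelyManySplitPlaces (cm_exists_split_notMem_of_eventually)

variable (L : Type) [Field L] [NumberField L] [IsCMField L]

/-- **Law (T′), global form: a family of local classes of `U(Φ₂)` that is ONE-DIMENSIONAL at every split place is not `ρ(θ)` with `θ` regular.**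
For Rogawski's unitary auxiliary character `μω` and a family `π₂ = (π₂,v)_v` of classes of `U(Φ₂)(L⁺_v)` with `π₂ v = ⟦r⟧`, `Module.finrank ℂ r.V = 1` at every
place `v` of `L⁺` split in `L`: `¬ IsThetaOfRecord L μω π₂`.  (Cofinitely many member places meet the infinitely many split places; at a split place the
member would be a constituent of the irreducible, infinite-dimensional unitary principal series `i_{GL₂(L_w)}(ν₁, ν₃)`.)
[cite: Rogawski1990, §11.1 Prop. 11.1.1 (a) p. 161; §11.4 Prop. 11.4.1 (a) p. 166; §13.8 p. 218] [cite: Zelevinsky1980, Thm. 4.2] -/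
theorem not_isThetaOfRecord_of_oneDim (μω : HeckeCharacter L) (hμu : μω.IsUnitary)
    (π₂ : ∀ v : HeightOneSpectrum (𝓞 ↥(maximalRealSubfield L)),
      IrrClass ((UnitaryGroup.cmDatum L 2 (Matrix.of fun i j : Fin 2 => if i.val + j.val + 1 = 2 then (1 : L) else 0)).Local v))
    (hπ₂ : ∀ v : HeightOneSpectrum (𝓞 ↥(maximalRealSubfield L)), (∃ w : PlacesOver L v, IsCMField.complexConj L • w.1 ≠ w.1) →
      ∃ r : SmoothIrrep ((UnitaryGroup.cmDatum L 2 (Matrix.of fun i j : Fin 2 => if i.val + j.val + 1 = 2 then (1 : L) else 0)).Local v),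
        Module.finrank ℂ r.V = 1 ∧ π₂ v = IrrClass.mk r) :
    ¬ IsThetaOfRecord L μω π₂ := by
  rintro ⟨θ₁, θ₃, h₁, h₃, -, hev⟩
  -- a SPLIT place carrying the membership (split places are infinite, the membership is cofinite)
  obtain ⟨v, -, hmem, hs⟩ := cm_exists_split_notMem_of_eventually L hev Set.finite_empty
  obtain ⟨r, hr, hπ⟩ := hπ₂ v hs
  -- the split clause of `IsThetaMemberAt` at the fixed witness `w = splitWitness v hs`, for the one-dimensional `π₂ v = ⟦r⟧`
  have h := hmem.1 hs
  rw [hπ] at h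
  exact not_isConstituentOf_parabolicIndGL_two_comap_of_finrank_eq_one _ _
    (norm_thetaSplitChar_apply L θ₁ h₁ hμu (splitWitness v hs).1) (continuous_thetaSplitChar L θ₁ h₁ μω (splitWitness v hs).1)
    (norm_thetaSplitChar_apply L θ₃ h₃ hμu (splitWitness v hs).1) (continuous_thetaSplitChar L θ₃ h₃ μω (splitWitness v hs).1)
    _ r hr h

end Summit.HodgeConjecture.HodgeConjecture.R90.S5

end
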